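import Mathlib
import Literature.AlgebraicGeometry.Resolution.RegularLocalRingsProofs
import Literature.AlgebraicGeometry.Resolution.RegularLocalRingsNormal
import Literature.AlgebraicGeometry.Resolution.RegularLocalRingsUFD
import Literature.AlgebraicGeometry.Resolution.AffineDomainDimension
import Literature.RingTheory.Derivation.WronskianPurity
import Literature.RingTheory.Derivation.RadicialDerivations
import Literature.RingTheory.Derivation.MonogenicBasis
import Literature.RingTheory.Derivation.RegularRadicialCotangent
import Literature.RingTheory.Flat.FiniteRegularFree
import HarnessLib

set_option linter.dupNamespace false -- mandated namespace of this single-conjunct summit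

/-!
# Regularity of the degree-`p` radicial cover forces a good representative

Crux `Picover` (stmt-ResolutionOfSingularities-0554), line `degree-p-tower`, stub
`exists_good_representative_of_isRegularRing_of_radicial` — the corrected form (with the radicial
hypothesis `S^p ⊆ R`, without which the statement fails for `𝔽_p ⊂ 𝔽_{p^p}`) of the registered
`exists_good_representative_of_isRegularRing`: direction `⇒` of the "forcing at a singular point"
criterion.

**Setting.** `(R, 𝔪)` regular local of prime characteristic `p`; `S` a normal domain, finite over
`R` of generic rank `p`, with `S^p ⊆ R`; `S` a regular ring. **Claim.** There are `s ∈ S ∖ R` and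
`h = s^p ∈ R` with `h - c^p ∉ 𝔪²` for every `c ∈ R`.

**Proof.**
* `S` is local (`s ↦ s^p` makes `Spec S → Spec R` injective), hence regular local, and `R → S` is
  a local homomorphism with `𝔪S` primary for the maximal ideal `𝔫`.
* *Case A* (the residue field grows): a unit `s` whose residue is not in the image of `κ(R)`
  works, with `h = s^p` even *wound*: `h - c^p ∉ 𝔪` (Frobenius is injective on `κ(S)`).
* *Case B* (`κ(R) = κ(S)`): this is the rank-`p` case of the Kimura–Niitsuma theorem (a regular
  local ring finite over a regular local subring containing its `p`-th powers has a `p`-basis),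
  proved here directly by a *purity argument for derivations*:
  1. `S` is free over `R` (a regular system of parameters of `R` is an `S`-regular sequence,
     Matsumura 23.1), say with basis `e₁, …, e_p`.
  2. For `θ ∈ S ∖ R`, `θ^p = h`, the map `R[T]/(T^p - h) → S` is injective with `R`-torsion
     cokernel, and `d/dT` transports to a non-zero `R`-derivation `D₀` of `S`; dividing by the
     gcd of the `D₀(eᵢ)` in the UFD `S` gives a derivation `D₁` whose values on the basis have no
     common prime factor.
  3. **Wronskian identity**: for any `R`-derivation `D` and any `θ`,
     `det (D^j θ^l)_{l,j<p} = (∏ l!) · (Dθ)^{p(p-1)/2}`, and `(D^j θ^l) = N · (D^j eᵢ)` with `N`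
     the coordinate matrix of the powers of `θ`. Hence no prime of `S` divides
     `det (D₁^j eᵢ)`, which is therefore a unit; so some `D₁(eᵢ)` is a unit, and after rescaling
     and translating by a constant, `D t = 1` for some `t ∈ 𝔫`.
  4. Applying `D^j` to a relation shows `1, t, …, t^{p-1}` are independent modulo `𝔪S`; as
     `dim_κ S/𝔪S = p` they form an `R`-basis of `S` (Nakayama).
  5. With this basis, if `h = t^p ∈ 𝔪²` the constant-coefficient functional `ρ` satisfies
     `ρ(𝔫²) ⊆ 𝔪²`; a dependence among the `d + 1` vectors `t, u₁, …, u_d` (`uᵢ` minimal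
     generators of `𝔪`, `d = dim R = dim S`) in `𝔫/𝔫²` then either makes `1 = D t ∈ 𝔫`
     or lets `𝔪` be generated by `d - 1` elements — contradicting regularity. So `h ∉ 𝔪²`,
     whence `h - c^p ∉ 𝔪²` for all `c` and `t ∉ R`.

References: T. Kimura, H. Niitsuma, *Regular local ring of characteristic `p` and `p`-basis*,
J. Math. Soc. Japan 32 (1980) (the general `p`-basis theorem; only its rank-`p` case is proved
here, by a different argument); H. Matsumura, *Commutative Ring Theory*, Thms. 17.4, 23.1, 14.2,
20.3 and the closing remark of §26. No statement item is restated; all helpers are private.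
-/

universe u

namespace Summit.ResolutionOfSingularities.ResolutionOfSingularities.Theorems.Picover.GoodRepresentativeConverse

open Polynomial IsLocalRing Module
open Literature.AlgebraicGeometry.Resolution Literature.RingTheory.Flat
  Literature.RingTheory.Derivation

/-! ### Locality, Case A, and the theorem -/

/-- **Locality.** If `R` is local, `S` is a non-trivial integral `R`-algebra and every `s ∈ S`
has `s^p ∈ R` (`p ≠ 0`), then `S` is local: a maximal ideal `Q` is determined by
`Q ∩ R = 𝔪_R`, as `s ∈ Q ↔ s^p ∈ Q`. [folklore] -/
private theorem isLocalRing_of_pow_mem_range {R S : Type*} [CommRing R] [IsLocalRing R]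
    [CommRing S] [Nontrivial S] [Algebra R S] [Algebra.IsIntegral R S] {p : ℕ} (hp : p ≠ 0)
    (hrad : ∀ s : S, s ^ p ∈ (algebraMap R S).range) : IsLocalRing S := by
  have key : ∀ (Q : Ideal S) [Q.IsMaximal] (s : S), s ∈ Q ↔
      ∃ r ∈ maximalIdeal R, algebraMap R S r = s ^ p := by
    intro Q hQ s
    have hcomap : Q.comap (algebraMap R S) = maximalIdeal R :=
      IsLocalRing.eq_maximalIdeal (Ideal.isMaximal_comap_of_isIntegral_of_isMaximal Q)
    constructor
    · intro hs
      obtain ⟨r, hr⟩ := hrad s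
      refine ⟨r, ?_, hr⟩
      rw [← hcomap, Ideal.mem_comap, hr]
      exact Q.pow_mem_of_mem hs p (Nat.pos_of_ne_zero hp)
    · rintro ⟨r, hr, hrs⟩
      rw [← hcomap, Ideal.mem_comap, hrs] at hr
      exact hQ.isPrime.mem_of_pow_mem p hr
  obtain ⟨Q₀, hQ₀⟩ := Ideal.exists_maximal S
  refine IsLocalRing.of_unique_max_ideal ⟨Q₀, hQ₀, fun Q hQ => ?_⟩
  ext s
  rw [key Q s, key Q₀ s]

/-- **Case A: the residue field grows.** If `κ(R) → κ(S)` is not onto, a unit `s ∈ S` with new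
residue and `h = s^p ∈ R` satisfy `s ∉ R` and `h - c^p ∉ 𝔪 ⊇ 𝔪²` for all `c` (Frobenius is
injective on the reduced ring `κ(S)`). [folklore] -/
private theorem caseA {p : ℕ} [Fact p.Prime] {R S : Type*} [CommRing R] [IsLocalRing R]
    [CommRing S] [IsLocalRing S] [CharP S p] [Algebra R S] [IsLocalHom (algebraMap R S)]
    (hrad : ∀ s : S, s ^ p ∈ (algebraMap R S).range)
    (hns : ¬ Function.Surjective (ResidueField.map (algebraMap R S))) :
    ∃ (h : R) (s : S), s ^ p = algebraMap R S h ∧ s ∉ (algebraMap R S).range ∧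
      ∀ c : R, h - c ^ p ∉ maximalIdeal R ^ 2 := by
  simp only [Function.Surjective, not_forall, not_exists] at hns
  obtain ⟨σ, hσ⟩ := hns
  obtain ⟨s, rfl⟩ := residue_surjective σ
  obtain ⟨r, hr⟩ := RingHom.mem_range.mp (hrad s)
  have hwound : ∀ c : R, r - c ^ p ∉ maximalIdeal R := by
    intro c hc
    apply hσ (residue R c)
    rw [ResidueField.map_residue]
    have h1 : (s - algebraMap R S c) ^ p ∈ maximalIdeal S := by
      rw [sub_pow_char, ← map_pow, ← hr, ← map_sub]
      exact map_nonunit (algebraMap R S) _ hc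
    have h2 : s - algebraMap R S c ∈ maximalIdeal S :=
      (inferInstance : (maximalIdeal S).IsPrime).mem_of_pow_mem p h1
    rw [eq_comm, ← sub_eq_zero, ← map_sub, residue_eq_zero_iff]
    exact h2
  refine ⟨r, s, hr.symm, ?_, fun c hc => hwound c (Ideal.pow_le_self two_ne_zero hc)⟩
  rintro ⟨r', rfl⟩
  exact hσ (residue R r') (by rw [ResidueField.map_residue])

/-- For `l < p` prime, `l!` is a unit in any ring of characteristic `p`. [folklore] -/
private theorem isUnit_natCast_factorial {A : Type*} [CommRing A] {p : ℕ} (hp : p.Prime)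
    [CharP A p] {l : ℕ} (hl : l < p) : IsUnit ((l.factorial : ℕ) : A) := by
  have hcop : (l.factorial).Coprime p :=
    (Nat.coprime_comm.mp (hp.coprime_iff_not_dvd.mpr (fun h => by
      rw [hp.dvd_factorial] at h; omega)))
  have h1 : IsUnit ((l.factorial : ℕ) : ZMod p) := (ZMod.isUnit_iff_coprime _ _).mpr hcop
  have h2 := h1.map (ZMod.castHom (dvd_refl p) A)
  rwa [map_natCast] at h2

/-- **Regularity of the degree-`p` radicial cover forces a good representative** (direction `⇒`
of the forcing criterion at a singular point; rank-`p` Kimura–Niitsuma). Let `R` be a regular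
local ring of prime characteristic `p`, `S` a normal domain finite over `R` of rank `p` with
`R ↪ S` and `S^p ⊆ R`. If `S` is a regular ring then some `s ∈ S ∖ R` has `h = s^p ∈ R` with
`h - c^p ∉ 𝔪²` for every `c ∈ R` (the rank-`p` case of the Kimura–Niitsuma `p`-basis theorem
quoted at the end of Matsumura's §26, proved here by Wronskian purity).
[cite: Matsumura1987, §26 (closing remark: Kimura–Niitsuma)] -/
theorem exists_good_representative_of_isRegularRing_of_radicial : ∀ {p : ℕ} [Fact p.Prime] {R : Type u} [CommRing R] [IsRegularLocalRing R] [CharP R p] {S : Type u} [CommRing S] [IsDomain S] [Algebra R S] [Module.Finite R S] [FaithfulSMul R S] [IsIntegrallyClosed S], Module.finrank R S = p → (∀ s : S, s ^ p ∈ (algebraMap R S).range) → IsRegularRing S → ∃ (h : R) (s : S), s ^ p = algebraMap R S h ∧ s ∉ (algebraMap R S).range ∧ ∀ c : R, h - c ^ p ∉ IsLocalRing.maximalIdeal R ^ 2 := by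
  intro p _ R _ _ _ S _ _ _ _ _ _ hrank hrad hreg
  have hp : p.Prime := Fact.out
  have hinj := FaithfulSMul.algebraMap_injective R S
  haveI : IsDomain R := isDomain_of_isRegularLocalRing R
  haveI : CharP S p := charP_of_injective_algebraMap hinj p
  haveI : Algebra.IsIntegral R S := inferInstance
  -- `S` is local, hence regular local, and `R → S` is a local homomorphism
  haveI : IsLocalRing S := isLocalRing_of_pow_mem_range hp.ne_zero hrad
  haveI := hreg
  haveI : IsRegularLocalRing S := IsRegularLocalRing.of_isRegularRing_of_isLocalRing S
  have hcomap : (maximalIdeal S).comap (algebraMap R S) = maximalIdeal R :=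
    IsLocalRing.eq_maximalIdeal (Ideal.isMaximal_comap_of_isIntegral_of_isMaximal _)
  haveI : IsLocalHom (algebraMap R S) := by
    refine ⟨fun r hr => ?_⟩
    by_contra hru
    have h1 : r ∈ maximalIdeal R := (mem_maximalIdeal _).mpr hru
    rw [← hcomap, Ideal.mem_comap] at h1
    exact (mem_maximalIdeal _).mp h1 hr
  by_cases hsurj : Function.Surjective (ResidueField.map (algebraMap R S))
  swap
  · exact caseA hrad hsurj
  -- Case B: the residue fields agree
  set 𝔪 := maximalIdeal R with h𝔪
  set 𝔫 := maximalIdeal S with h𝔫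
  have hmap : ∀ r ∈ 𝔪, algebraMap R S r ∈ 𝔫 := fun r hr => map_nonunit (algebraMap R S) r hr
  have hrefl : ∀ r : R, algebraMap R S r ∈ 𝔫 → r ∈ 𝔪 := fun r hr =>
    (mem_maximalIdeal _).mpr fun hu => (mem_maximalIdeal _).mp hr (hu.map _)
  -- some `θ₀ ∈ S ∖ R`
  obtain ⟨θ₀, hθ₀⟩ : ∃ θ₀ : S, θ₀ ∉ (algebraMap R S).range := by
    by_contra hall
    push Not at hall
    have hsurj' : Function.Surjective (algebraMap R S) := fun s => hall s
    let e : R ≃ₐ[R] S := AlgEquiv.ofBijective (Algebra.ofId R S) ⟨hinj, hsurj'⟩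
    have h1 := e.toLinearEquiv.finrank_eq
    rw [Module.finrank_self, hrank] at h1
    exact hp.one_lt.ne h1
  -- `S` is not a field: `𝔫 ≠ 0`
  have hnbot : 𝔫 ≠ ⊥ := by
    intro hbot
    apply hθ₀
    obtain ⟨k, hk⟩ := hsurj (residue S θ₀)
    obtain ⟨c, rfl⟩ := residue_surjective k
    rw [ResidueField.map_residue] at hk
    refine ⟨c, ?_⟩
    rw [← sub_eq_zero, ← Ideal.mem_bot, ← hbot, ← residue_eq_zero_iff, map_sub, hk, sub_self]
  -- dimensions and the `𝔫`-primary ideal `𝔪S`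
  have hdim : ringKrullDim S = ringKrullDim R := ringKrullDim_eq_of_isIntegral hinj
  have hprim : ∃ N : ℕ, 𝔫 ^ N ≤ 𝔪.map (algebraMap R S) := by
    refine Ideal.exists_pow_le_of_le_radical_of_fg ?_ (IsNoetherian.noetherian 𝔫)
    intro s hs
    obtain ⟨r, hr⟩ := hrad s
    have hrm : r ∈ 𝔪 := hrefl r (by rw [hr]; exact 𝔫.pow_mem_of_mem hs p hp.pos)
    exact ⟨p, by rw [← hr]; exact Ideal.mem_map_of_mem _ hrm⟩
  -- Step 1: `S` is free over `R`
  haveI : Module.Free R S := free_of_isRegularLocalRing_of_maximalIdeal_pow_le hdim hprim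
  let e : Basis (Fin p) R S := Module.finBasisOfFinrankEq R S hrank
  -- Step 2: a saturated `R`-derivation
  obtain ⟨h₀, hh₀⟩ := hrad θ₀
  haveI : UniqueFactorizationMonoid R := IsRegularLocalRing.uniqueFactorizationMonoid R
  haveI : IsIntegrallyClosed R := isIntegrallyClosed_of_isRegularLocalRing R
  obtain ⟨D₀, hD₀⟩ := exists_derivation_apply_ne_zero hrank hθ₀ hh₀.symm
  haveI : UniqueFactorizationMonoid S := IsRegularLocalRing.uniqueFactorizationMonoid S
  obtain ⟨D₁, hsat⟩ := exists_saturated_derivation e D₀ ⟨θ₀, hD₀⟩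
  -- Step 3: some `D₁ (e i)` is a unit (Wronskian purity)
  have hprime : ∃ π : S, Prime π := by
    obtain ⟨x, hx, hx0⟩ := Submodule.exists_mem_ne_zero_of_ne_bot hnbot
    exact UniqueFactorizationMonoid.exists_prime_iff.mpr ⟨x, hx0, (mem_maximalIdeal _).mp hx⟩
  have hunit := isUnit_det_basisWronskian D₁ e hsat
    (fun l hl => isUnit_natCast_factorial hp hl) hprime
  obtain ⟨i, hi⟩ := exists_isUnit_derivation_apply_basis hp.two_le D₁ e hunit
  -- normalise: `D t = 1` with `t ∈ 𝔫`
  let D : Derivation R S S := (↑(hi.unit⁻¹) : S) • D₁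
  have hDei : D (e i) = 1 := by
    show (↑(hi.unit⁻¹) : S) • D₁ (e i) = 1
    rw [smul_eq_mul]
    exact hi.val_inv_mul
  obtain ⟨c, hc⟩ : ∃ c : R, e i - algebraMap R S c ∈ 𝔫 := by
    obtain ⟨k, hk⟩ := hsurj (residue S (e i))
    obtain ⟨c, rfl⟩ := residue_surjective k
    rw [ResidueField.map_residue] at hk
    exact ⟨c, by rw [← residue_eq_zero_iff, map_sub, hk, sub_self]⟩
  set t : S := e i - algebraMap R S c with ht_def
  have hDt : D t = 1 := by rw [ht_def, map_sub, Derivation.map_algebraMap, sub_zero, hDei]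
  -- Step 4: `1, t, …, t^{p-1}` is a basis
  obtain ⟨b, hb⟩ := exists_basis_pow_of_derivation_eq_one hrank (fun l hl => isUnit_natCast_factorial hp hl) D hDt
  -- Step 5: `h = t^p ∉ 𝔪²`
  obtain ⟨h, hh⟩ := hrad t
  obtain ⟨n, rfl⟩ : ∃ n, p = n + 2 := ⟨p - 2, by have := hp.two_le; omega⟩
  have key : h ∉ 𝔪 ^ 2 := not_mem_maximalIdeal_sq_of_basis_pow b hb hc hh.symm D hDt hdim
  have hhm : h ∈ 𝔪 := hrefl h (by rw [hh]; exact 𝔫.pow_mem_of_mem hc _ hp.pos)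
  refine ⟨h, t, hh.symm, ?_, fun c' hc' => key ?_⟩
  · rintro ⟨r, hr⟩
    have : D t = 0 := by rw [← hr, Derivation.map_algebraMap]
    rw [hDt] at this
    exact one_ne_zero this
  · have h1 : c' ^ (n + 2) ∈ 𝔪 := by
      have := 𝔪.sub_mem hhm (Ideal.pow_le_self two_ne_zero hc')
      rwa [sub_sub_cancel] at this
    have h2 : c' ∈ 𝔪 := (inferInstance : 𝔪.IsPrime).mem_of_pow_mem _ h1
    have h3 : c' ^ (n + 2) ∈ 𝔪 ^ 2 :=
      Ideal.pow_le_pow_right (by omega) (Ideal.pow_mem_pow h2 _)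
    have := Ideal.add_mem _ hc' h3
    rwa [sub_add_cancel] at this

end Summit.ResolutionOfSingularities.ResolutionOfSingularities.Theorems.Picover.GoodRepresentativeConverse
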